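import Mathlib
import Summits.NavierStokesRegularity.NavierStokesRegularity.Theorems.EulerZoomLiouvillePowerGaugeEulerLiouvilleNeedleAxisymLogCapacity
import Summits.NavierStokesRegularity.NavierStokesRegularity.Theorems.EulerZoomLiouvillePowerGaugeEulerLiouvilleNeedleAxisymMeridian

/-!
# Needle portrait, axisymmetric case: LEMMA K ON ONE SPHERE (ROUND-37 plate t38j, part A)

Seat nsreg-p2 (`HOME/ns-regularity-ideate-p2/ROUND-37.md` §1 (K), v1.3); helper material for crux E
(`EulerZoomLiouville.PowerGaugeEulerLiouville`, stmt-NavierStokesRegularity-19832); nothing is wired into the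
LEAD's skeleton.  Assembly of t38h (`sin_le_sqrt_mul_exp_of_level`, the 1-D log-capacity lemma) with t38i
(the sphere reduction):

* `cylRadius_le_of_fast` — **Lemma K on the sphere `S_t`**: for a `C¹` axisymmetric field `V` with sphere
  budgets `∫_0^π ‖V p‖² sin ≤ A`, `∫_0^π ‖DV p‖² sin ≤ E` (`p = sphericalPt t θ 0`) and parameters
  `4A ≤ μγ²t²`, `μ ≤ 2/5`, `1 ≤ Λ`, `4π(t²E + A)Λ ≤ γ²t²`, every `γ`-fast point `x ∈ S_t`
  (`⟪x, V x⟫ ≤ −γt²`) lies in the axial tube `cylRadius x ≤ t·√(2πμ)·e^{−Λ}`;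
* `lintegral_sphereBudget_eq_ofReal` — the inner integral of t38d's spherical Tonelli,
  `∫⁻_{θ ∈ (0,π)} ofReal(t² sin θ)·‖F p‖ₑ²`, equals `ofReal (t² ∫_0^π ‖F p‖² sin θ dθ)` for continuous `F`,
  and `integral_sphere_le_of_lintegral_le` turns a bound of the former into the real budget of the latter;
* `measurable_sphereBudget` — measurability of `t ↦ ∫⁻_{θ ∈ (0,π)} ofReal(t² sin θ)·G(sphericalPt t θ 0)`
  (the `Φ` of t38d `volume_setOf_sphereBudget_ge_le`, i.e. the good-radii selection).

Part B (next file) selects the good radii in `(R, 2R)` and packages the tube into the hypothesis `hthin` of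
`…NeedleRace.curl_eq_zero_of_thinFastExits`.
Namespace `…PowerGaugeEulerLiouville.NeedleAxisymBand` (shared with t38a/t38h/t38i), new names only.
-/

open MeasureTheory Set Real intervalIntegral
open scoped ENNReal
open Literature.Analysis Literature.Analysis.FluidPDE
open Summit.NavierStokesRegularity.NavierStokesRegularity.Theorems.PowerGaugeEulerLiouville.NeedleSphericalTonelli

set_option linter.dupNamespace false

namespace Summit.NavierStokesRegularity.NavierStokesRegularity.Theorems.PowerGaugeEulerLiouville.NeedleAxisymBand

-- (the plate's `local notation "E3"` was spelled out at the gate by the firing seat: notation in Theorems files routes to review)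

variable {V : (EuclideanSpace ℝ (Fin 3)) → (EuclideanSpace ℝ (Fin 3))} {V' : (EuclideanSpace ℝ (Fin 3)) → (EuclideanSpace ℝ (Fin 3)) →L[ℝ] (EuclideanSpace ℝ (Fin 3))}

/-! ### 1. Lemma K on one sphere -/

/-- **Lemma K on the sphere `S_t`** (t38h ∘ t38i): a `γ`-fast point of an axisymmetric `C¹` field with
sphere budgets `A`, `E` lies within `t·√(2πμ)·e^{−Λ}` of the axis. -/
theorem cylRadius_le_of_fast (hV : ∀ y, HasFDerivAt V (V' y) y) (hV'c : Continuous V')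
    (hax : IsAxisymmetric V) {t γ A E μ Λ : ℝ} (ht : 0 < t) (hγ : 0 < γ)
    (hA : ∫ θ in (0 : ℝ)..π, ‖V (sphericalPt t θ 0)‖ ^ 2 * Real.sin θ ≤ A)
    (hE : ∫ θ in (0 : ℝ)..π, ‖V' (sphericalPt t θ 0)‖ ^ 2 * Real.sin θ ≤ E)
    (hμA : 4 * A ≤ μ * (γ ^ 2 * t ^ 2)) (hμ : μ ≤ 2 / 5) (hΛ : 1 ≤ Λ)
    (hΛD : 4 * π * (t ^ 2 * E + A) * Λ ≤ γ ^ 2 * t ^ 2)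
    {x : (EuclideanSpace ℝ (Fin 3))} (hx : ‖x‖ = t) (hfast : inner ℝ x (V x) ≤ -(γ * t ^ 2)) :
    cylRadius x ≤ t * (Real.sqrt (2 * π * μ) * Real.exp (-Λ)) := by
  have hm : 0 < γ * t ^ 2 := by positivity
  have ht2 : 0 ≤ t ^ 2 := sq_nonneg t
  obtain ⟨θ₀, hθ₀, hfθ₀, hcyl⟩ := meridianInflow_ge_of_fast hax ht hx hfast
  have hD₁ : ∫ θ in (0 : ℝ)..π, meridianInflowDeriv V V' t θ ^ 2 * Real.sin θ ≤
      2 * t ^ 2 * (t ^ 2 * E + A) := by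
    refine (integral_meridianInflowDeriv_sq_mul_sin_le hV hV'c ht).trans ?_
    have h1 : t ^ 2 * (∫ θ in (0 : ℝ)..π, ‖V' (sphericalPt t θ 0)‖ ^ 2 * Real.sin θ) ≤ t ^ 2 * E :=
      mul_le_mul_of_nonneg_left hE ht2
    nlinarith
  have hΛD' : 2 * π * (2 * t ^ 2 * (t ^ 2 * E + A)) * Λ ≤ (γ * t ^ 2) ^ 2 := by
    have h1 : 2 * π * (2 * t ^ 2 * (t ^ 2 * E + A)) * Λ = t ^ 2 * (4 * π * (t ^ 2 * E + A) * Λ) := by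
      ring
    rw [h1, show (γ * t ^ 2) ^ 2 = t ^ 2 * (γ ^ 2 * t ^ 2) by ring]
    exact mul_le_mul_of_nonneg_left hΛD ht2
  have hcheb : ∀ a b : ℝ, 0 ≤ a → a ≤ b → b ≤ π →
      (∀ θ ∈ Icc a b, γ * t ^ 2 / 2 ≤ meridianInflow V t θ) → Real.cos a - Real.cos b ≤ μ := by
    intro a b ha hab hb hband
    refine (cos_sub_cos_le_of_band hV ht hm ha hab hb hband).trans ?_
    rw [div_le_iff₀ (by positivity)]
    have h2 : 4 * t ^ 2 * (∫ θ in (0 : ℝ)..π, ‖V (sphericalPt t θ 0)‖ ^ 2 * Real.sin θ) ≤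
        4 * t ^ 2 * A := mul_le_mul_of_nonneg_left hA (by positivity)
    have h3 : 4 * t ^ 2 * A ≤ μ * (γ * t ^ 2) ^ 2 := by
      rw [show μ * (γ * t ^ 2) ^ 2 = t ^ 2 * (μ * (γ ^ 2 * t ^ 2)) by ring]
      nlinarith
    linarith
  have hsin := sin_le_sqrt_mul_exp_of_level (hasDerivAt_meridianInflow hV t)
    (continuous_meridianInflowDeriv hV hV'c t) hm hμ hΛ hΛD' hcheb hD₁ hθ₀ hfθ₀
  rw [hcyl]
  exact mul_le_mul_of_nonneg_left hsin ht.le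

/-- The same with the fast condition in the `…NeedleRace` form `⟪V x, x⟫ + γ‖x‖² < 0`. -/
theorem cylRadius_le_of_fast' (hV : ∀ y, HasFDerivAt V (V' y) y) (hV'c : Continuous V')
    (hax : IsAxisymmetric V) {t γ A E μ Λ : ℝ} (ht : 0 < t) (hγ : 0 < γ)
    (hA : ∫ θ in (0 : ℝ)..π, ‖V (sphericalPt t θ 0)‖ ^ 2 * Real.sin θ ≤ A)
    (hE : ∫ θ in (0 : ℝ)..π, ‖V' (sphericalPt t θ 0)‖ ^ 2 * Real.sin θ ≤ E)
    (hμA : 4 * A ≤ μ * (γ ^ 2 * t ^ 2)) (hμ : μ ≤ 2 / 5) (hΛ : 1 ≤ Λ)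
    (hΛD : 4 * π * (t ^ 2 * E + A) * Λ ≤ γ ^ 2 * t ^ 2)
    {x : (EuclideanSpace ℝ (Fin 3))} (hx : ‖x‖ = t) (hfast : inner ℝ (V x) x + γ * ‖x‖ ^ 2 < 0) :
    cylRadius x ≤ t * (Real.sqrt (2 * π * μ) * Real.exp (-Λ)) := by
  refine cylRadius_le_of_fast hV hV'c hax ht hγ hA hE hμA hμ hΛ hΛD hx ?_
  rw [real_inner_comm, hx] at hfast
  linarith

/-! ### 2. The sphere budgets: from t38d's `ℝ≥0∞` inner integrals to real `θ`-integrals -/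

/-- `∫⁻_{θ ∈ (0,π)} ofReal(t² sin θ)·‖F p‖ₑ² = ofReal (t² ∫_0^π ‖F p‖² sin θ dθ)` for continuous `F`. -/
theorem lintegral_sphereBudget_eq_ofReal {X : Type*} [NormedAddCommGroup X] {F : (EuclideanSpace ℝ (Fin 3)) → X}
    (hF : Continuous F) (t : ℝ) :
    ∫⁻ θ in Ioo 0 π, ENNReal.ofReal (t ^ 2 * Real.sin θ) * ‖F (sphericalPt t θ 0)‖ₑ ^ 2 =
      ENNReal.ofReal (t ^ 2 * ∫ θ in (0 : ℝ)..π, ‖F (sphericalPt t θ 0)‖ ^ 2 * Real.sin θ) := by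
  have hc : Continuous fun θ : ℝ => ‖F (sphericalPt t θ 0)‖ ^ 2 * Real.sin θ :=
    ((hF.comp (continuous_sphericalPt_theta t 0)).norm.pow 2).mul Real.continuous_sin
  have h1 : ∫⁻ θ in Ioo 0 π, ENNReal.ofReal (t ^ 2 * Real.sin θ) * ‖F (sphericalPt t θ 0)‖ₑ ^ 2 =
      ∫⁻ θ in Ioo 0 π, ENNReal.ofReal (t ^ 2 * (‖F (sphericalPt t θ 0)‖ ^ 2 * Real.sin θ)) := by
    refine setLIntegral_congr_fun measurableSet_Ioo fun θ hθ => ?_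
    have hs : 0 ≤ Real.sin θ := Real.sin_nonneg_of_mem_Icc ⟨hθ.1.le, hθ.2.le⟩
    rw [← ofReal_norm, ← ENNReal.ofReal_pow (norm_nonneg _), ← ENNReal.ofReal_mul (by positivity)]
    congr 1
    ring
  have hint : IntegrableOn (fun θ : ℝ => t ^ 2 * (‖F (sphericalPt t θ 0)‖ ^ 2 * Real.sin θ)) (Ioo 0 π) :=
    ((hc.const_mul _).integrableOn_Icc).mono_set Ioo_subset_Icc_self
  have hnn : 0 ≤ᵐ[volume.restrict (Ioo 0 π)]
      fun θ : ℝ => t ^ 2 * (‖F (sphericalPt t θ 0)‖ ^ 2 * Real.sin θ) := by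
    refine (ae_restrict_mem measurableSet_Ioo).mono fun θ hθ => ?_
    have hs : 0 ≤ Real.sin θ := Real.sin_nonneg_of_mem_Icc ⟨hθ.1.le, hθ.2.le⟩
    simp only [Pi.zero_apply]
    positivity
  rw [h1, ← intervalIntegral.integral_const_mul, intervalIntegral.integral_of_le Real.pi_pos.le,
    integral_Ioc_eq_integral_Ioo, ofReal_integral_eq_lintegral_ofReal hint hnn]

/-- A bound `∫⁻_{θ ∈ (0,π)} ofReal(t² sin θ)·‖F p‖ₑ² ≤ ε < ∞` gives the real budget `t² ∫_0^π ‖F p‖² sin ≤ ε.toReal`.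
-/
theorem integral_sphere_le_of_lintegral_le {X : Type*} [NormedAddCommGroup X] {F : (EuclideanSpace ℝ (Fin 3)) → X}
    (hF : Continuous F) {t : ℝ} {ε : ℝ≥0∞} (hε : ε ≠ ∞)
    (h : ∫⁻ θ in Ioo 0 π, ENNReal.ofReal (t ^ 2 * Real.sin θ) * ‖F (sphericalPt t θ 0)‖ₑ ^ 2 ≤ ε) :
    t ^ 2 * ∫ θ in (0 : ℝ)..π, ‖F (sphericalPt t θ 0)‖ ^ 2 * Real.sin θ ≤ ε.toReal := by
  rw [lintegral_sphereBudget_eq_ofReal hF t] at h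
  exact (ENNReal.ofReal_le_iff_le_toReal hε).1 h

/-! ### 3. Measurability of the sphere budget in the radius -/

/-- `t ↦ ∫⁻_{θ ∈ (0,π)} ofReal(t² sin θ)·G(sphericalPt t θ 0)` is measurable for measurable `G`. -/
theorem measurable_sphereBudget {G : (EuclideanSpace ℝ (Fin 3)) → ℝ≥0∞} (hG : Measurable G) :
    Measurable fun t : ℝ => ∫⁻ θ in Ioo 0 π, ENNReal.ofReal (t ^ 2 * Real.sin θ) * G (sphericalPt t θ 0) := by
  have hu : Measurable (Function.uncurry fun t θ : ℝ =>
      ENNReal.ofReal (t ^ 2 * Real.sin θ) * G (sphericalPt t θ 0)) := by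
    refine Measurable.mul ?_ (hG.comp (continuous_sphericalPt_left 0).measurable)
    exact ((measurable_fst.pow_const 2).mul (Real.measurable_sin.comp measurable_snd)).ennreal_ofReal
  exact hu.lintegral_prod_right

/-- The two budgets of Lemma K are instances: `G = ‖V‖ₑ²` and `G = ‖DV‖ₑ²`. -/
theorem measurable_sphereBudget_enorm_sq {X : Type*} [NormedAddCommGroup X] [MeasurableSpace X]
    [OpensMeasurableSpace X] {F : (EuclideanSpace ℝ (Fin 3)) → X} (hF : Measurable F) :
    Measurable fun t : ℝ => ∫⁻ θ in Ioo 0 π, ENNReal.ofReal (t ^ 2 * Real.sin θ) * ‖F (sphericalPt t θ 0)‖ₑ ^ 2 :=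
  measurable_sphereBudget (hF.enorm.pow_const 2)

end Summit.NavierStokesRegularity.NavierStokesRegularity.Theorems.PowerGaugeEulerLiouville.NeedleAxisymBand
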